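import Summits.Ventures.PercRepro.FaceCodes

/-!
# The list of big faces of a `k`-edge cube

`bigFaces k t` lists the code pairs `(encode u, encode v)` of the faces `(u, v)` with at most `t`
fixed edges (`mem_bigFaces_of`), so that `facesCheckList m (bigFaces k (k − 9))` checks every face
with more than eight free edges (`card_face_add_fixedCount`).
-/

namespace PercRepro

namespace MultiGraph

open Finset

/-- The code pairs of the faces of a `k`-edge cube with at most `t` fixed edges: edge `0` free
(`u` bit set, `v` bit clear), fixed open (both set) or fixed closed (both clear), then the rest. -/
def bigFaces : ℕ → ℕ → List (ℕ × ℕ)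
  | 0, _ => [(0, 0)]
  | k + 1, t =>
    (bigFaces k t).map (fun q => (2 * q.1 + 1, 2 * q.2)) ++
      (if t = 0 then [] else
        (bigFaces k (t - 1)).map (fun q => (2 * q.1 + 1, 2 * q.2 + 1)) ++
          (bigFaces k (t - 1)).map (fun q => (2 * q.1, 2 * q.2)))

/-- The number of fixed (not free) edges of a face. -/
def fixedCount {k : ℕ} (u v : Config (Fin k)) : ℕ :=
  ∑ e : Fin k, if v e = false ∧ u e = true then 0 else 1

/-- The fixed count on `k + 1` edges: the edge `0` and the rest. -/
theorem fixedCount_succ {k : ℕ} (u v : Config (Fin (k + 1))) :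
    fixedCount u v = (if v 0 = false ∧ u 0 = true then 0 else 1) +
      fixedCount (fun e => u e.succ) (fun e => v e.succ) := by
  unfold fixedCount
  rw [Fin.sum_univ_succ]

/-- **Every face with at most `t` fixed edges is listed.** -/
theorem mem_bigFaces_of {k : ℕ} (u v : Config (Fin k)) (hvu : v ≤ u) {t : ℕ}
    (ht : fixedCount u v ≤ t) : (encode u, encode v) ∈ bigFaces k t := by
  induction k generalizing t with
  | zero => simp [bigFaces, encode]
  | succ k ih =>
    have hle := hvu 0
    have ih' : ∀ {t' : ℕ}, fixedCount (fun e => u e.succ) (fun e => v e.succ) ≤ t' →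
        (encode (fun e => u e.succ), encode (fun e => v e.succ)) ∈ bigFaces k t' :=
      fun h => ih (fun e => u e.succ) (fun e => v e.succ) (fun e => hvu e.succ) h
    rw [encode_succ u, encode_succ v, fixedCount_succ] at *
    simp only [bigFaces, List.mem_append, List.mem_map]
    cases hv : v 0 <;> cases hu : u 0 <;> rw [hv, hu] at ht
    · -- fixed closed
      simp only [Bool.false_eq_true, and_false, ↓reduceIte] at ht
      have ht' : t ≠ 0 := by omega
      refine Or.inr ?_
      rw [if_neg ht', List.mem_append, List.mem_map, List.mem_map]
      refine Or.inr ⟨_, ih' (t' := t - 1) (by omega), ?_⟩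
      simp
    · -- free
      simp only [and_self, ↓reduceIte, zero_add] at ht
      refine Or.inl ⟨_, ih' ht, ?_⟩
      simp [add_comm]
    · rw [hv, hu] at hle
      exact absurd hle Bool.false_lt_true.not_ge
    · -- fixed open
      simp only [Bool.true_eq_false, false_and, ↓reduceIte] at ht
      have ht' : t ≠ 0 := by omega
      refine Or.inr ?_
      rw [if_neg ht', List.mem_append, List.mem_map, List.mem_map]
      refine Or.inl ⟨_, ih' (t' := t - 1) (by omega), ?_⟩
      simp [add_comm]

/-- The free and the fixed edges of a face partition the edges. -/
theorem card_face_add_fixedCount {k : ℕ} (u v : Config (Fin k)) :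
    Fintype.card (Face u v) + fixedCount u v = k := by
  classical
  have hface : Fintype.card (Face u v) = (univ.filter fun x => v x = false ∧ u x = true).card :=
    (Fintype.card_congr (Equiv.refl _)).trans (Fintype.card_subtype _)
  have hfix : fixedCount u v = (univ.filter fun x => ¬ (v x = false ∧ u x = true)).card := by
    unfold fixedCount
    rw [Finset.card_filter]
    refine Finset.sum_congr rfl fun e _ => ?_
    split_ifs <;> simp_all
  rw [hface, hfix, card_filter_add_card_filter_not, card_univ, Fintype.card_fin]

/-- **The list `bigFaces k (k − 9)` covers every face with more than eight free edges.** -/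
theorem mem_bigFaces_of_card_face_gt {k : ℕ} (u v : Config (Fin k)) (hvu : v ≤ u)
    (h8 : 8 < Fintype.card (Face u v)) : (encode u, encode v) ∈ bigFaces k (k - 9) := by
  have := card_face_add_fixedCount u v
  exact mem_bigFaces_of u v hvu (by omega)

end MultiGraph

end PercRepro
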